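import Summits.AtomisticToContinuum.HydrodynamicLimit.Theorems.CollisionIsometryCLTAdaptedWeightCLTBHDVTransferStep
import Summits.AtomisticToContinuum.HydrodynamicLimit.Theorems.CollisionIsometryCLTAdaptedWeightCLTBHDVTransferExpMoment
import Summits.AtomisticToContinuum.HydrodynamicLimit.Theorems.CollisionIsometryCLTAdaptedWeightCLTBHDVTransferLogChaos
import Summits.AtomisticToContinuum.HydrodynamicLimit.Theorems.CollisionIsometryCLTAdaptedWeightCLTBHDVTransferInputs
import Summits.AtomisticToContinuum.HydrodynamicLimit.Theorems.CollisionIsometryCLTAdaptedWeightCLTBHDVTransferHellinger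

/-!
# DV transfer for the line `block-h-dissipation-closure` (crux `AdaptedWeightCLT`, stmt-AtomisticToContinuum-14868),
# file 12: the unconditional Donsker–Varadhan step per cell-window, in the typed vocabulary of the inputs

Support file (`--supports stmt-AtomisticToContinuum-14868`, anchor `bhDVTransfer_main_anchor`) of the line lead
`prover-line-stmt-AtomisticToContinuum-14868-c4-0`; the S2 worker's top file for the registered stub `stub_dvTransfer`.
VERDICT on the stub: MIS-STATED (see file 7, `…BHDVTransferInputs`, and the worker's reply): the transfer
`EntropyChaosRelOn ⇒ OneSidedOn` holds in the conditional form `DVTransferStub'` (`dvTransferStub'_holds`), whose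
inputs G1 (`IncrToMeasureOn`), G3 (`CrossHellingerOn`), G4 (`ChaosTimeOn`) are per-contact commutator statements
not controlled by `TailsOn` + `FewCollisionsOn`, and whose input G2 (`DVAggregateOn`) is the `x`-integrated,
`k`-summed form of the theorem of this file.

* `dv_step'` — **the Donsker–Varadhan step, unconditional**: for a nonnegative kernel family, `h ≠ 0`, `0 < δ ≤ 1`,
  a good initial datum and a cell-window off the junk case (`cellOK = 1`, i.e. `pairZ(Φ_{kΔ} z, x) > 0`),
  `crossE − klTerm ≤ dvAct` — the four integrability side conditions of `dv_step` (file 5) are discharged by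
  files 9–11 (`integrable_contactDens_mul_log`, `integrable_contactDens_mul_log_chaosDens`,
  `integrable_dLam_mul_contactDens`, `integrable_exp_half_dLam_mul_chaosDens`);
* `klTerm_nonneg'` — `0 ≤ klTerm` off the junk case, unconditionally; with `klTerm_eq_zero_of_pairZ_eq_zero` (file 5)
  `klTerm ≥ 0` ALWAYS on the good set (`klTerm_nonneg_all`), so `relEnt` is a sum of nonnegative terms there;
* `cellOK_mul_crossE_sub_klTerm_le` — the same inequality multiplied by the junk indicator, valid at EVERY `x`
  (both sides vanish in the junk case), i.e. the integrand form of G2.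

No definitions.
-/

namespace Summit.AtomisticToContinuum.HydrodynamicLimit.Theorems.BlockHDissipation

open scoped BigOperators Topology Classical MeasureTheory ENNReal InnerProductSpace
open Filter Set MeasureTheory Real
open Literature.Analysis.FluidPDE
open Summit.AtomisticToContinuum.HydrodynamicLimit.Theorems.ContactSourceDuhamel (T3 V3 Cfg Vel Flow Flows)
open Summit.AtomisticToContinuum.HydrodynamicLimit.Theorems.ContactSourceDuhamel.TimeLocal
open Literature.MathematicalPhysics.KineticTheory (hsDiameter localGibbsLaw collide hardSphereKernel sphereMeasure)

noncomputable section

namespace DVTransfer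

variable {σ : ℝ} {N : ℕ} {ψ : ℕ → T3 → ℝ}

/-- **`klTerm ≥ 0` off the junk case, unconditionally** (nonnegative kernel family, `h ≠ 0`, good initial datum,
`pairZ(Φ_{kΔ} z, x) > 0`). -/
theorem klTerm_nonneg' (hψ : ∀ N y, 0 ≤ ψ N y) {h : ℝ} (hh : h ≠ 0) (Φ : Flow σ N) (γc t : ℝ) {z : Cfg N}
    (hz : z ∈ Φ.good) (k : ℕ) (x : T3) (hZ : 0 < pairZ N ψ (Φ.flow ((k : ℝ) * winW γc N) z) x) :
    0 ≤ klTerm σ N Φ ψ γc h t z k x :=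
  klTerm_nonneg hψ hh Φ γc t hz k x hZ (integrable_contactDens_mul_log hψ hh Φ γc t hz k x)
    (integrable_contactDens_mul_log_chaosDens hψ hh Φ γc t hz k x _ hZ)

/-- **`klTerm ≥ 0` on the good set, always** (junk case included: there `klTerm = 0`). -/
theorem klTerm_nonneg_all (hψ : ∀ N y, 0 ≤ ψ N y) {h : ℝ} (hh : h ≠ 0) (Φ : Flow σ N) (γc t : ℝ) {z : Cfg N}
    (hz : z ∈ Φ.good) (k : ℕ) (x : T3) : 0 ≤ klTerm σ N Φ ψ γc h t z k x := by
  rcases (pairZ_nonneg hψ N (Φ.flow ((k : ℝ) * winW γc N) z) x).eq_or_lt with h0 | hpos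
  · exact (klTerm_eq_zero_of_pairZ_eq_zero Φ ψ γc h t z k x h0.symm).symm.le
  · exact klTerm_nonneg' hψ hh Φ γc t hz k x hpos

/-- **The Donsker–Varadhan step per cell-window, unconditional**: for a nonnegative kernel family, `h ≠ 0`,
`0 < δ ≤ 1`, a good initial datum and a cell-window off the junk case, `crossE − klTerm ≤ dvAct`:
the contact mass times the smeared cross-Hellinger defect of the chaos reference, minus the relative entropy of
the smeared contact law, bounds from below one half of the DV action of the realised contacts. -/
theorem dv_step' (hψ : ∀ N y, 0 ≤ ψ N y) {h : ℝ} (hh : h ≠ 0) {δ : ℝ} (hδ0 : 0 < δ) (hδ1 : δ ≤ 1) (Φ : Flow σ N)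
    (γc t : ℝ) {z : Cfg N} (hz : z ∈ Φ.good) (k : ℕ) (x : T3)
    (hZ : 0 < pairZ N ψ (Φ.flow ((k : ℝ) * winW γc N) z) x) :
    crossE σ N Φ ψ γc h δ t z k x - klTerm σ N Φ ψ γc h t z k x ≤ dvAct σ N Φ ψ γc h δ t z k x :=
  dv_step hψ hh δ Φ γc t hz k x hZ (integrable_contactDens_mul_log hψ hh Φ γc t hz k x)
    (integrable_contactDens_mul_log_chaosDens hψ hh Φ γc t hz k x _ hZ)
    (integrable_dLam_mul_contactDens hψ hh hδ0 hδ1 Φ γc t hz k x _)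
    (integrable_exp_half_dLam_mul_chaosDens hψ hh hδ0 hδ1 _ x hZ)

/-- **Integrand form of G2 at every location**: `cellOK · crossE − klTerm ≤ cellOK · dvAct` for all `x` on the good
set (in the junk case `cellOK = 0` and `klTerm = 0`). Integrating in `x`, summing over `k < nWin` and dividing by
`N + 1` gives `crossEW − relEnt ≤ dvActW`, i.e. `DVAggregateOn` with zero slack, as soon as the three functions of `x`
are integrable on `𝕋³`. -/
theorem cellOK_mul_crossE_sub_klTerm_le (hψ : ∀ N y, 0 ≤ ψ N y) {h : ℝ} (hh : h ≠ 0) {δ : ℝ} (hδ0 : 0 < δ)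
    (hδ1 : δ ≤ 1) (Φ : Flow σ N) (γc t : ℝ) {z : Cfg N} (hz : z ∈ Φ.good) (k : ℕ) (x : T3) :
    cellOK σ N Φ ψ γc z k x * crossE σ N Φ ψ γc h δ t z k x - klTerm σ N Φ ψ γc h t z k x ≤
      cellOK σ N Φ ψ γc z k x * dvAct σ N Φ ψ γc h δ t z k x := by
  unfold cellOK
  split_ifs with hZ
  · rw [one_mul, one_mul]; exact dv_step' hψ hh hδ0 hδ1 Φ γc t hz k x hZ
  · have h0 : pairZ N ψ (Φ.flow ((k : ℝ) * winW γc N) z) x = 0 :=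
      le_antisymm (not_lt.1 hZ) (pairZ_nonneg hψ N _ x)
    rw [zero_mul, zero_mul, klTerm_eq_zero_of_pairZ_eq_zero Φ ψ γc h t z k x h0, sub_zero]

/-- **Aggregation** (deterministic form of G2 on one good orbit): if for every `k < nWin` the three functions
`x ↦ cellOK · crossE`, `x ↦ klTerm`, `x ↦ cellOK · dvAct` are integrable on `𝕋³`, then `crossEW − relEnt ≤ dvActW`. -/
theorem crossEW_sub_relEnt_le_dvActW (hψ : ∀ N y, 0 ≤ ψ N y) {h : ℝ} (hh : h ≠ 0) {δ : ℝ} (hδ0 : 0 < δ)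
    (hδ1 : δ ≤ 1) (Φ : Flow σ N) (γc t : ℝ) {z : Cfg N} (hz : z ∈ Φ.good)
    (iE : ∀ k ∈ Finset.range (nWin γc N t), Integrable (fun x : T3 => cellOK σ N Φ ψ γc z k x * crossE σ N Φ ψ γc h δ t z k x))
    (iK : ∀ k ∈ Finset.range (nWin γc N t), Integrable (fun x : T3 => klTerm σ N Φ ψ γc h t z k x))
    (iA : ∀ k ∈ Finset.range (nWin γc N t), Integrable (fun x : T3 => cellOK σ N Φ ψ γc z k x * dvAct σ N Φ ψ γc h δ t z k x)) :
    crossEW σ N Φ ψ γc h δ t z - relEnt σ N Φ ψ γc h t z ≤ dvActW σ N Φ ψ γc h δ t z := by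
  unfold crossEW relEnt dvActW
  rw [← mul_sub, ← Finset.sum_sub_distrib]
  refine mul_le_mul_of_nonneg_left (Finset.sum_le_sum fun k hk => ?_) (inv_nonneg.2 (Nat.cast_nonneg _))
  rw [← integral_sub (iE k hk) (iK k hk)]
  exact integral_mono ((iE k hk).sub (iK k hk)) (iA k hk) fun x =>
    cellOK_mul_crossE_sub_klTerm_le hψ hh hδ0 hδ1 Φ γc t hz k x

/-- **G2 from `x`-integrability.** If, for every `N` and `localGibbsLaw`-a.e. initial datum in the good set, the
three functions `x ↦ cellOK · crossE`, `x ↦ klTerm`, `x ↦ cellOK · dvAct` are integrable on `𝕋³` for every window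
`k < nWin`, then `DVAggregateOn` holds (with zero slack: the bad events are null). This isolates the only missing
piece of G2 — measurability and boundedness in the cell location `x` of three explicit parametric integrals. -/
theorem dvAggregateOn_of_xIntegrable (hψ : ∀ N y, 0 ≤ ψ N y) {h : ℝ} (hh : h ≠ 0) {δ : ℝ} (hδ0 : 0 < δ)
    (hδ1 : δ ≤ 1) {a₀ θ₀ : T3 → ℝ} {u₀ : T3 → V3} (Φ : Flows σ) (γc t : ℝ)
    (hI : ∀ N : ℕ, ∀ᵐ z ∂(localGibbsLaw σ a₀ u₀ θ₀ N (Φ N)), z ∈ (Φ N).good →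
      ∀ k ∈ Finset.range (nWin γc N t),
        Integrable (fun x : T3 => cellOK σ N (Φ N) ψ γc z k x * crossE σ N (Φ N) ψ γc h δ t z k x) ∧
        Integrable (fun x : T3 => klTerm σ N (Φ N) ψ γc h t z k x) ∧
        Integrable (fun x : T3 => cellOK σ N (Φ N) ψ γc z k x * dvAct σ N (Φ N) ψ γc h δ t z k x)) :
    DVAggregateOn σ a₀ θ₀ u₀ Φ ψ γc h δ t := by
  intro η hη
  have hzero : ∀ N : ℕ, localGibbsLaw σ a₀ u₀ θ₀ N (Φ N)
      {z | dvActW σ N (Φ N) ψ γc h δ t z + η * ((N + 1 : ℕ) : ℝ) ^ ((1 : ℝ) / 3) <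
        crossEW σ N (Φ N) ψ γc h δ t z - relEnt σ N (Φ N) ψ γc h t z} = 0 := by
    intro N
    rw [measure_eq_zero_iff_ae_notMem]
    filter_upwards [Literature.MathematicalPhysics.KineticTheory.ae_mem_good_localGibbsLaw σ a₀ u₀ θ₀ N (Φ N), hI N]
      with z hz hIz
    have hdet := crossEW_sub_relEnt_le_dvActW hψ hh hδ0 hδ1 (Φ N) γc t hz
      (fun k hk => ((hIz hz) k hk).1) (fun k hk => ((hIz hz) k hk).2.1) (fun k hk => ((hIz hz) k hk).2.2)
    have hS : 0 ≤ η * ((N + 1 : ℕ) : ℝ) ^ ((1 : ℝ) / 3) :=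
      mul_nonneg hη.le (Real.rpow_nonneg (Nat.cast_nonneg _) _)
    simp only [not_lt]
    linarith
  simp only [hzero]
  exact tendsto_const_nhds

end DVTransfer

/-! ## Registered anchor of this support file -/

/-- ANCHOR (registered helper stub `bhDVTransfer_main_anchor` of the crux item): the unconditional Donsker–Varadhan
step per cell-window — for a nonnegative kernel family, `h ≠ 0`, `0 < δ ≤ 1`, a good initial datum and a
cell-window with positive window-start pair flux, `crossE − klTerm ≤ dvAct`. -/
theorem bhDVTransfer_main_anchor : ∀ (σ : ℝ) (N : ℕ) (ψ : ℕ → T3 → ℝ), (∀ N y, 0 ≤ ψ N y) → ∀ (h : ℝ), h ≠ 0 → ∀ (δ : ℝ), 0 < δ → δ ≤ 1 → ∀ (Φ : Flow σ N) (γc t : ℝ) (z : Cfg N), z ∈ Φ.good → ∀ (k : ℕ) (x : T3), 0 < pairZ N ψ (Φ.flow ((k : ℝ) * winW γc N) z) x → crossE σ N Φ ψ γc h δ t z k x - klTerm σ N Φ ψ γc h t z k x ≤ dvAct σ N Φ ψ γc h δ t z k x :=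
  fun _ _ _ hψ _ hh _ hδ0 hδ1 Φ γc t _ hz k x hZ => DVTransfer.dv_step' hψ hh hδ0 hδ1 Φ γc t hz k x hZ

end

end Summit.AtomisticToContinuum.HydrodynamicLimit.Theorems.BlockHDissipation
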